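import Literature.AlgebraicGeometry.Resolution.WeightedResolutionDatum
import Literature.AlgebraicGeometry.Resolution.CobordantBlowupGlobal
import Literature.AlgebraicGeometry.Resolution.CobordantBlowupRegularCentre
import Literature.AlgebraicGeometry.Resolution.ProjectiveSpaceRegular
import Literature.AlgebraicGeometry.Resolution.SmoothStalksRegular
import Mathlib.AlgebraicGeometry.Morphisms.Smooth
import Mathlib.AlgebraicGeometry.Morphisms.Separated
import Mathlib.AlgebraicGeometry.Morphisms.QuasiCompact
import Mathlib.AlgebraicGeometry.Morphisms.FiniteType
import Mathlib.AlgebraicGeometry.Noetherian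
import Mathlib.RingTheory.RingHom.FiniteType
import HarnessLib

/-!
# The full cobordant blow-up of a regular weighted centre is regular (Włodarczyk 2.3.9)

Topic: `Summits/ResolutionOfSingularities/ResolutionOfSingularities/Theorems`. Stub
`stub_cobordantBlowup_regular` of the line `support-first-weights-second` of the crux
`Theses.WeightedInvariant.WeightedConstruction` (statement `stmt-ResolutionOfSingularities-0571`)
of the summit `Summit.ResolutionOfSingularities.ResolutionOfSingularities`.

For a regular weighted centre `R` (datum sense, `ReesAlgebraData.IsRegularWeightedCentre`) on a
smooth separated quasi-compact scheme `Y` over a field and ANY affine open `U ⊆ Y`, the full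
cobordant blow-up `B(U) = Spec Γ(Y, U)[t⁻¹, Rₙ(U) tⁿ]` (`affineCobordantBlowup (R.chartIdeals U)`)
is a regular scheme and `B(U) → Spec Γ(Y, U)` is locally of finite type — granted the bridge
`extReesAlgebra F.ideal = F.extendedRees` between the datum file's extended Rees algebra and the
tree's `IdealFiltration.extendedRees` (the statement of the neighbouring stub, a hypothesis here).

Route (J. Włodarczyk, arXiv:2203.03090, §2.3.9, "`B` is a regular closed subscheme of
`X × 𝔸ⁿ⁺¹`", plus Zariski-locality):

* the pieces `R.piece n` of a regular weighted centre decrease with `n` (checked on the charts,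
  `Scheme.IdealSheafData.le_of_iSup_eq_top`), so `R` is a `ReesFiltration` and, by the bridge,
  `Γ(B(U)) = ⊕ₙ Rₙ(U) tⁿ` is the tree's `ReesFiltration.sectionsRing U`;
* `U` is covered by opens `D(g)` that are basic open both in `U` and in a chart `U'` of the centre
  (`exists_basicOpen_le_affine_inter`); a weighted chart restricts to a weighted chart on any
  smaller affine open (`Scheme.IdealSheafData.map_ideal`), so over `D(g)` the sections ring is the
  affine model `Γ(D(g))[t⁻¹, uᵢ t^{wᵢ}]` (`ReesFiltration.sectionsRing_eq_cobordantAlgebra`), a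
  regular ring (`cobordantAlgebra.isRegularRing_of_linearIndependent_toCotangent`, the chart's
  linear independence read in the stalks `IsAffineOpen.isLocalization_stalk'`) of finite type;
* `⊕ Rₙ(D(g)) tⁿ` is the localisation of `⊕ Rₙ(U) tⁿ` at `g`
  (`IdealFiltration.isLocalization_away_extendedRees`), so `B(U)` is covered by the regular open
  subschemes `Spec ⊕ Rₙ(D(g)) tⁿ` and `Γ(Y, U) → Γ(B(U))` is of finite type by Zariski-locality of
  finite type on the target (`RingHom.finiteType_ofLocalizationSpanTarget`).
-/

noncomputable section

open CategoryTheory CategoryTheory.Limits AlgebraicGeometry TopologicalSpace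
open Literature.AlgebraicGeometry.Resolution
open scoped LaurentPolynomial

-- the summit namespace repeats `ResolutionOfSingularities` by design
set_option linter.dupNamespace false

namespace Summit.ResolutionOfSingularities.ResolutionOfSingularities.Theorems

universe u

/-! ## Weighted monomial ideals and weighted charts -/

/-- The datum file's monomial ideal `(u^α : Σ wᵢ αᵢ ≥ n)` (exponents `α : Fin m → ℕ`) is the
`n`-th piece of the tree's weighted filtration (exponents `α : Fin m →₀ ℕ`). [folklore] -/
theorem weightedMonomialIdeal_eq_span_weightedMonomials {A : Type*} [CommRing A] {m : ℕ}
    (u : Fin m → A) (w : Fin m → ℕ) (n : ℕ) :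
    weightedMonomialIdeal u w n = Ideal.span (weightedMonomials u w n) := by
  have hw : ∀ α : Fin m →₀ ℕ, Finsupp.weight w α = ∑ i, w i * α i := fun α => by
    rw [Finsupp.weight_apply, Finsupp.sum_fintype _ _ (fun i => zero_smul ℕ (w i))]
    exact Finset.sum_congr rfl fun i _ => (smul_eq_mul _ _).trans (mul_comm _ _)
  have hp : ∀ α : Fin m →₀ ℕ, α.prod (fun i e => u i ^ e) = ∏ i, u i ^ α i := fun α =>
    Finsupp.prod_fintype _ _ (fun i => pow_zero (u i))
  unfold weightedMonomialIdeal weightedMonomials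
  congr 1
  ext x
  constructor
  · rintro ⟨α, hα, rfl⟩
    refine ⟨Finsupp.equivFunOnFinite.symm α, ?_, ?_⟩
    · rw [hw]
      exact hα
    · rw [hp]
      rfl
  · rintro ⟨α, hα, rfl⟩
    exact ⟨α, by rwa [hw] at hα, hp α⟩

/-- The algebra `A[t⁻¹, u₁ t^{w₁}, …, uₘ t^{wₘ}]` of the full cobordant blow-up is of finite type
over `A` (it is a quotient of `A[s, u₁', …, uₘ']`, Włodarczyk §2.3.9). [folklore] -/
theorem finiteType_cobordantAlgebra {A : Type*} [CommRing A] {m : ℕ} (u : Fin m → A)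
    (w : Fin m → ℕ) : Algebra.FiniteType A (cobordantAlgebra u w) :=
  Algebra.FiniteType.of_surjective (cobordantAlgebra.presentation u w)
    (cobordantAlgebra.presentation_surjective u w)

/-- **A weighted chart restricts to a weighted chart** on every smaller affine open: the pieces of
an ideal sheaf restrict (`Scheme.IdealSheafData.map_ideal`), monomial ideals map to monomial
ideals, and the germs of the restricted parameters are the germs of the parameters. [folklore] -/
theorem isWeightedChart_restrict {Y : Scheme.{u}} {R : ReesAlgebraData Y} {U' : Y.affineOpens}
    {m : ℕ} {u : Fin m → Γ(Y, U')} {w : Fin m → ℕ} (h : R.IsWeightedChart U' u w)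
    (W : Y.affineOpens) (hW : W ≤ U') :
    R.IsWeightedChart W (fun i => (Y.presheaf.map (homOfLE hW).op).hom (u i)) w where
  w_pos := h.w_pos
  ideal_eq n := by
    rw [← (R.piece n).map_ideal hW, h.ideal_eq n, weightedMonomialIdeal_eq_span_weightedMonomials,
      ← weightedFiltration_ideal, map_weightedFiltration_ideal, weightedFiltration_ideal,
      weightedMonomialIdeal_eq_span_weightedMonomials]
    rfl
  linearIndependent y hy hmem := by
    have hy' : y ∈ (U' : Y.Opens) := hW hy
    have hgerm : ∀ i, (Y.presheaf.germ (W : Y.Opens) y hy).hom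
        ((Y.presheaf.map (homOfLE hW).op).hom (u i)) =
          (Y.presheaf.germ (U' : Y.Opens) y hy').hom (u i) :=
      fun i => TopCat.Presheaf.germ_res_apply Y.presheaf (homOfLE hW) y hy (u i)
    have hmem' : ∀ i, (Y.presheaf.germ (U' : Y.Opens) y hy').hom (u i) ∈
        IsLocalRing.maximalIdeal (Y.presheaf.stalk y) := fun i => hgerm i ▸ hmem i
    have key := h.linearIndependent y hy' hmem'
    have hfun : (fun i => (IsLocalRing.maximalIdeal (Y.presheaf.stalk y)).toCotangent
        ⟨_, hmem i⟩) = fun i => (IsLocalRing.maximalIdeal (Y.presheaf.stalk y)).toCotangent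
          ⟨_, hmem' i⟩ :=
      funext fun i => congrArg _ (Subtype.ext (hgerm i))
    rw [hfun]
    exact key

/-- **Włodarczyk 2.3.9 on a weighted chart**: on a regular locally Noetherian scheme `Y`, for a
weighted chart `(W, u, w)` of a Rees algebra `R` the algebra `Γ(Y, W)[t⁻¹, uᵢ t^{wᵢ}]` of the full
cobordant blow-up is a regular ring — the affine theorem
`cobordantAlgebra.isRegularRing_of_linearIndependent_toCotangent`, its hypothesis at a prime
`P ⊇ (u)` of `Γ(Y, W)` being the chart's linear independence in the cotangent space of the stalk
`𝒪_{Y,y}`, `y` the point of `W` corresponding to `P` (a localisation of `Γ(Y, W)` at `P`).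
[cite: Wlodarczyk2022, §2.3.9] -/
theorem isRegularRing_cobordantAlgebra_of_isWeightedChart {Y : Scheme.{u}} [IsLocallyNoetherian Y]
    (hY : Scheme.IsRegular Y) {R : ReesAlgebraData Y} {W : Y.affineOpens} {m : ℕ}
    {u : Fin m → Γ(Y, W)} {w : Fin m → ℕ} (h : R.IsWeightedChart W u w) :
    IsRegularRing (cobordantAlgebra u w) := by
  haveI : IsRegularRing Γ(Y, W) := hY.isRegularRing_of_isAffineOpen W.2
  refine cobordantAlgebra.isRegularRing_of_linearIndependent_toCotangent u w h.w_pos ?_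
  intro P _ hP
  let p : PrimeSpectrum Γ(Y, W) := ⟨P, ‹_›⟩
  have hy : W.2.fromSpec p ∈ (W : Y.Opens) := by
    rw [← SetLike.mem_coe, ← W.2.range_fromSpec]
    exact ⟨p, rfl⟩
  letI : Algebra Γ(Y, W) (Y.presheaf.stalk (W.2.fromSpec p)) :=
    TopCat.Presheaf.algebra_section_stalk Y.presheaf ⟨W.2.fromSpec p, hy⟩
  haveI : IsLocalization.AtPrime (Y.presheaf.stalk (W.2.fromSpec p)) P :=
    W.2.isLocalization_stalk' p hy
  haveI : IsRegularLocalRing (Y.presheaf.stalk (W.2.fromSpec p)) := hY _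
  have hmem : ∀ i, algebraMap Γ(Y, W) (Y.presheaf.stalk (W.2.fromSpec p)) (u i) ∈
      IsLocalRing.maximalIdeal _ := fun i =>
    (IsLocalization.AtPrime.to_map_mem_maximal_iff (Y.presheaf.stalk (W.2.fromSpec p)) P
      (u i)).mpr (hP (Ideal.subset_span ⟨i, rfl⟩))
  exact ⟨Y.presheaf.stalk (W.2.fromSpec p), inferInstance, inferInstance, inferInstance,
    inferInstance, hmem, h.linearIndependent _ hy hmem⟩

/-! ## A regular weighted centre is a Rees filtration -/

/-- The pieces `Rₙ` of a regular weighted centre decrease with `n`: on every chart they are the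
monomial ideals `(u^α : Σ wᵢ αᵢ ≥ n)`, and an inequality of ideal sheaves may be checked on an
affine open cover (`Scheme.IdealSheafData.le_of_iSup_eq_top`). [folklore] -/
theorem antitone_piece {Y : Scheme.{u}} {R : ReesAlgebraData Y}
    (hR : R.IsRegularWeightedCentre) : Antitone R.piece := by
  intro n n' hnn'
  choose U hyU m u w hc using hR
  refine Scheme.IdealSheafData.le_of_iSup_eq_top U ?_ fun y => ?_
  · exact top_le_iff.mp fun y _ => Opens.mem_iSup.mpr ⟨y, hyU y⟩
  · rw [(hc y).ideal_eq n', (hc y).ideal_eq n]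
    exact weightedMonomialIdeal_antitone _ _ hnn'

/-! ## The sections rings `⊕ Rₙ(U) tⁿ` of a Rees filtration localize -/

section Localization

variable {Y : Scheme.{u}} (RF : ReesFiltration Y) (U : Y.affineOpens) (g : Γ(Y, U))

/-- **Quasi-coherence of `⊕ Rₙ tⁿ`**: along the restriction `⊕ Rₙ(U) tⁿ → ⊕ Rₙ(D(g)) tⁿ` (base
change of Laurent polynomials along `Γ(Y, U) → Γ(Y, D(g))`, `IdealFiltration.extendedReesMap`),
`⊕ Rₙ(D(g)) tⁿ` is the localisation of `⊕ Rₙ(U) tⁿ` at `g t⁰`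
(`IdealFiltration.isLocalization_away_extendedRees` with `Rₙ(D(g)) = Rₙ(U) Γ(D(g))`), cf.
`ReesFiltration.coequifibered_diagramMap`. [cite: Wlodarczyk2022, Def. 5.1.1] -/
theorem isLocalization_away_sectionsRing_basicOpen :
    letI := ((RF.filtration U).extendedReesMap (RF.filtration ⟨Y.basicOpen g, U.2.basicOpen g⟩)
      fun n => ((RF.ideal n).map_ideal_basicOpen U g).le).toAlgebra
    IsLocalization.Away (algebraMap Γ(Y, U) (RF.sectionsRing U) g)
      (RF.sectionsRing ⟨Y.basicOpen g, U.2.basicOpen g⟩) := by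
  haveI : IsLocalization.Away g Γ(Y, Y.basicOpen g) := U.2.isLocalization_basicOpen g
  exact (RF.filtration U).isLocalization_away_extendedRees
    (RF.filtration ⟨Y.basicOpen g, U.2.basicOpen g⟩) g
    fun n => ((RF.ideal n).map_ideal_basicOpen U g).symm

/-- The restriction of sections rings is compatible with the structure maps:
`Γ(Y, U) → ⊕ Rₙ(U) tⁿ → ⊕ Rₙ(D(g)) tⁿ` equals `Γ(Y, U) → Γ(Y, D(g)) → ⊕ Rₙ(D(g)) tⁿ`. [folklore] -/
theorem extendedReesMap_comp_algebraMap :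
    ((RF.filtration U).extendedReesMap (RF.filtration ⟨Y.basicOpen g, U.2.basicOpen g⟩)
      fun n => ((RF.ideal n).map_ideal_basicOpen U g).le).comp
        (algebraMap Γ(Y, U) (RF.sectionsRing U)) =
      (algebraMap Γ(Y, Y.basicOpen g) (RF.sectionsRing ⟨Y.basicOpen g, U.2.basicOpen g⟩)).comp
        (algebraMap Γ(Y, U) Γ(Y, Y.basicOpen g)) := by
  refine RingHom.ext fun a => Subtype.ext ?_
  rw [RingHom.comp_apply, RingHom.comp_apply, IdealFiltration.coe_extendedReesMap,
    Subalgebra.coe_algebraMap, Subalgebra.coe_algebraMap, ← LaurentPolynomial.C_eq_algebraMap,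
    ← LaurentPolynomial.C_eq_algebraMap, ← LaurentPolynomial.single_eq_C,
    AddMonoidAlgebra.mapRingHom_single, LaurentPolynomial.single_eq_C]

end Localization

/-! ## The charts of `B(U)` over the basic opens of `U` inside the charts of the centre -/

section Charts

variable {Y : Scheme.{u}} [IsLocallyNoetherian Y] {R : ReesAlgebraData Y}
  (RF : ReesFiltration Y) (hRF : ∀ n, RF.ideal n = R.piece n)

include hRF

/-- **Local structure of `B(U)`**: let `R` be a regular weighted centre on a regular locally
Noetherian scheme `Y`, viewed as a Rees filtration `RF` (same pieces), and `y` a point of an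
affine open `U`. There is `g ∈ Γ(Y, U)` with `y ∈ D(g)` such that `⊕ Rₙ(D(g)) tⁿ` is a regular
ring of finite type over `Γ(Y, D(g))`: take `D(g) = D(g')` basic open also in a chart `U' ∋ y`
(`exists_basicOpen_le_affine_inter`); the chart restricts to `D(g)`, over which the sections ring is
the affine model `Γ(D(g))[t⁻¹, uᵢ t^{wᵢ}]` (`cobordantAlgebra_eq_extendedRees`), regular by
Włodarczyk 2.3.9 and finitely generated. [cite: Wlodarczyk2022, §2.3.9] -/
theorem exists_basicOpen_isRegularRing_sectionsRing (hY : Scheme.IsRegular Y)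
    (hR : R.IsRegularWeightedCentre) (U : Y.affineOpens) {y : Y} (hy : y ∈ (U : Y.Opens)) :
    ∃ g : Γ(Y, U), y ∈ Y.basicOpen g ∧
      IsRegularRing (RF.sectionsRing ⟨Y.basicOpen g, U.2.basicOpen g⟩) ∧
        Algebra.FiniteType Γ(Y, Y.basicOpen g)
          (RF.sectionsRing ⟨Y.basicOpen g, U.2.basicOpen g⟩) := by
  obtain ⟨U', hyU', m, u, w, hc⟩ := hR y
  obtain ⟨g, g', e, hyg⟩ := exists_basicOpen_le_affine_inter U.2 U'.2 y ⟨hy, hyU'⟩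
  have hWU' : (⟨Y.basicOpen g, U.2.basicOpen g⟩ : Y.affineOpens) ≤ U' :=
    show Y.basicOpen g ≤ (U' : Y.Opens) from e.trans_le (Y.basicOpen_le g')
  have hc' := isWeightedChart_restrict hc ⟨Y.basicOpen g, U.2.basicOpen g⟩ hWU'
  -- over `D(g)` the filtration is the weighted filtration of the restricted chart, so the
  -- sections ring is the affine model (cf. `ReesFiltration.sectionsRing_eq_cobordantAlgebra`)
  have hF : RF.filtration ⟨Y.basicOpen g, U.2.basicOpen g⟩ =
      weightedFiltration (fun i => (Y.presheaf.map (homOfLE hWU').op).hom (u i)) w :=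
    IdealFiltration.ext' fun n => by
      rw [ReesFiltration.filtration_ideal, hRF n, hc'.ideal_eq n,
        weightedMonomialIdeal_eq_span_weightedMonomials, weightedFiltration_ideal]
  have hS : RF.sectionsRing ⟨Y.basicOpen g, U.2.basicOpen g⟩ =
      cobordantAlgebra (fun i => (Y.presheaf.map (homOfLE hWU').op).hom (u i)) w := by
    change (RF.filtration ⟨Y.basicOpen g, U.2.basicOpen g⟩).extendedRees = _
    rw [hF, cobordantAlgebra_eq_extendedRees]
  refine ⟨g, hyg, ?_, ?_⟩
  · rw [hS]
    exact isRegularRing_cobordantAlgebra_of_isWeightedChart hY hc'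
  · rw [hS]
    exact finiteType_cobordantAlgebra _ w

/-- **`B(U) = Spec ⊕ Rₙ(U) tⁿ` is a regular scheme** for a regular weighted centre on a regular
locally Noetherian `Y` and any affine open `U`: it is covered by the open subschemes
`Spec ⊕ Rₙ(D(g)) tⁿ` (localisations at the `g t⁰`, `isLocalization_away_sectionsRing_basicOpen`)
for the `D(g)` of `exists_basicOpen_isRegularRing_sectionsRing`, spectra of regular rings.
[cite: Wlodarczyk2022, §2.3.9] -/
theorem isRegular_Spec_sectionsRing (hY : Scheme.IsRegular Y) (hR : R.IsRegularWeightedCentre)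
    (U : Y.affineOpens) : Scheme.IsRegular (Spec (.of (RF.sectionsRing U))) := by
  apply Scheme.IsRegular.of_forall_exists_isOpenImmersion
  intro x
  -- the point of `U` under `x`
  let P : Ideal Γ(Y, U) := x.asIdeal.comap (algebraMap Γ(Y, U) (RF.sectionsRing U))
  haveI hP : P.IsPrime := Ideal.comap_isPrime _ _
  let p : PrimeSpectrum Γ(Y, U) := ⟨P, hP⟩
  have hyU : U.2.fromSpec p ∈ (U : Y.Opens) := by
    rw [← SetLike.mem_coe, ← U.2.range_fromSpec]
    exact ⟨p, rfl⟩
  obtain ⟨g, hyg, hreg, -⟩ := exists_basicOpen_isRegularRing_sectionsRing RF hRF hY hR U hyU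
  -- `g ∉ P`, i.e. `x ∈ D(g t⁰)`
  have hgP : g ∉ P := by
    have h1 : p ∈ U.2.fromSpec ⁻¹ᵁ Y.basicOpen g := hyg
    rw [U.2.fromSpec_preimage_basicOpen] at h1
    exact (PrimeSpectrum.mem_basicOpen _ _).mp h1
  letI := ((RF.filtration U).extendedReesMap (RF.filtration ⟨Y.basicOpen g, U.2.basicOpen g⟩)
      fun n => ((RF.ideal n).map_ideal_basicOpen U g).le).toAlgebra
  haveI := isLocalization_away_sectionsRing_basicOpen RF U g
  refine ⟨Spec (.of (RF.sectionsRing ⟨Y.basicOpen g, U.2.basicOpen g⟩)),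
    Spec.map (CommRingCat.ofHom (algebraMap (RF.sectionsRing U)
      (RF.sectionsRing ⟨Y.basicOpen g, U.2.basicOpen g⟩))),
    IsOpenImmersion.of_isLocalization (algebraMap Γ(Y, U) (RF.sectionsRing U) g), ?_, ?_⟩
  · -- `x` lies in the image `D(g t⁰)` of the chart
    have hx : x ∈ (PrimeSpectrum.basicOpen (algebraMap Γ(Y, U) (RF.sectionsRing U) g) :
        Set (PrimeSpectrum (RF.sectionsRing U))) :=
      (PrimeSpectrum.mem_basicOpen _ _).mpr hgP
    rw [← PrimeSpectrum.localization_away_comap_range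
      (RF.sectionsRing ⟨Y.basicOpen g, U.2.basicOpen g⟩)
      (algebraMap Γ(Y, U) (RF.sectionsRing U) g)] at hx
    obtain ⟨x', rfl⟩ := hx
    exact ⟨x', rfl⟩
  · haveI := hreg
    exact Scheme.isRegular_Spec _

/-- **`Γ(Y, U) → Γ(B(U)) = ⊕ Rₙ(U) tⁿ` is of finite type** for a regular weighted centre on a
regular locally Noetherian `Y` and any affine open `U`: finite type is Zariski-local on the target
(`RingHom.finiteType_ofLocalizationSpanTarget`); the `g t⁰` for the `D(g) ⊆ U` of
`exists_basicOpen_isRegularRing_sectionsRing` generate the unit ideal, and after inverting `g t⁰`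
the structure map becomes `Γ(Y, U) → Γ(Y, D(g)) → Γ(D(g))[t⁻¹, uᵢ t^{wᵢ}]`, of finite type.
[folklore] -/
theorem finiteType_algebraMap_sectionsRing (hY : Scheme.IsRegular Y)
    (hR : R.IsRegularWeightedCentre) (U : Y.affineOpens) :
    (algebraMap Γ(Y, U) (RF.sectionsRing U)).FiniteType := by
  have key : ∀ y : (U : Y.Opens), ∃ g : Γ(Y, U), (y : Y) ∈ Y.basicOpen g ∧
      Algebra.FiniteType Γ(Y, Y.basicOpen g) (RF.sectionsRing ⟨Y.basicOpen g, U.2.basicOpen g⟩) :=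
    fun y => by
      obtain ⟨g, hyg, -, hft⟩ := exists_basicOpen_isRegularRing_sectionsRing RF hRF hY hR U y.2
      exact ⟨g, hyg, hft⟩
  choose g hg hft using key
  have hspan : Ideal.span (Set.range g) = ⊤ := by
    rw [← U.2.self_le_iSup_basicOpen_iff]
    exact fun y hyU => Opens.mem_iSup.mpr ⟨⟨_, ⟨y, hyU⟩, rfl⟩, hg ⟨y, hyU⟩⟩
  refine RingHom.finiteType_ofLocalizationSpanTarget _
    ((algebraMap Γ(Y, U) (RF.sectionsRing U)) '' Set.range g) ?_ ?_
  · rw [← Ideal.map_span, hspan, Ideal.map_top]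
  · rintro ⟨_, _, ⟨y, rfl⟩, rfl⟩
    letI := ((RF.filtration U).extendedReesMap
      (RF.filtration ⟨Y.basicOpen (g y), U.2.basicOpen (g y)⟩)
        fun n => ((RF.ideal n).map_ideal_basicOpen U (g y)).le).toAlgebra
    haveI := isLocalization_away_sectionsRing_basicOpen RF U (g y)
    haveI : IsLocalization.Away (g y) Γ(Y, Y.basicOpen (g y)) := U.2.isLocalization_basicOpen (g y)
    let e := IsLocalization.algEquiv
      (Submonoid.powers (algebraMap Γ(Y, U) (RF.sectionsRing U) (g y)))
      (RF.sectionsRing ⟨Y.basicOpen (g y), U.2.basicOpen (g y)⟩)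
      (Localization.Away (algebraMap Γ(Y, U) (RF.sectionsRing U) (g y)))
    have he : algebraMap (RF.sectionsRing U)
        (Localization.Away (algebraMap Γ(Y, U) (RF.sectionsRing U) (g y))) =
          (e : _ →+* _).comp (algebraMap (RF.sectionsRing U)
            (RF.sectionsRing ⟨Y.basicOpen (g y), U.2.basicOpen (g y)⟩)) :=
      (e.toAlgHom.comp_algebraMap).symm
    change ((algebraMap (RF.sectionsRing U)
      (Localization.Away (algebraMap Γ(Y, U) (RF.sectionsRing U) (g y)))).comp
        (algebraMap Γ(Y, U) (RF.sectionsRing U))).FiniteType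
    rw [he, RingHom.comp_assoc, RingHom.algebraMap_toAlgebra, extendedReesMap_comp_algebraMap,
      ← RingHom.comp_assoc]
    exact ((RingHom.FiniteType.of_surjective _ e.surjective).comp
      (RingHom.finiteType_algebraMap.mpr (hft y))).comp
      (RingHom.finiteType_holdsForLocalizationAway Γ(Y, Y.basicOpen (g y)) (g y))

end Charts

/-! ## The stub -/

/-- **Włodarczyk 2.3.9 for the datum's charts** (stub `stub_cobordantBlowup_regular` of line
`support-first-weights-second`): granted the bridge `extReesAlgebra F.ideal = F.extendedRees`, for
a regular weighted centre `R` on a smooth separated quasi-compact scheme `Y` over a field and ANY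
affine open `U ⊆ Y`, the full cobordant blow-up `B(U) = Spec Γ(Y, U)[t⁻¹, Rₙ(U) tⁿ]` is a regular
scheme and `B(U) → Spec Γ(Y, U)` is locally of finite type. `Y` is regular (smooth over a field,
`isRegularLocalRing_stalk_of_smooth_of_field`) and locally Noetherian; the pieces of `R` decrease
(`antitone_piece`), so `R` is a Rees filtration and by the bridge `Γ(B(U))` is its sections ring
`⊕ Rₙ(U) tⁿ`, to which `isRegular_Spec_sectionsRing` and `finiteType_algebraMap_sectionsRing`
apply. [cite: Wlodarczyk2022, §2.3.9] -/
theorem stub_cobordantBlowup_regular :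
    (∀ (A : Type) [CommRing A] (F : IdealFiltration A), extReesAlgebra F.ideal = F.extendedRees) →
    ∀ ⦃k : Type⦄ [Field k] ⦃Y : Scheme.{0}⦄ (f : Y ⟶ Spec (.of k)) [Smooth f] [IsSeparated f]
      [QuasiCompact f] (R : ReesAlgebraData Y), R.IsRegularWeightedCentre → ∀ U : Y.affineOpens,
      Scheme.IsRegular (affineCobordantBlowup (R.chartIdeals U)) ∧
        LocallyOfFiniteType (affineCobordantBlowup.π (R.chartIdeals U)) := by
  intro bridge k _ Y f _ _ _ R hR U
  haveI : IsLocallyNoetherian Y := LocallyOfFiniteType.isLocallyNoetherian f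
  have hY : Scheme.IsRegular Y := fun y => isRegularLocalRing_stalk_of_smooth_of_field f y
  -- `R` as a Rees filtration (its pieces decrease)
  obtain ⟨RF, hRF⟩ : ∃ RF : ReesFiltration Y, ∀ n, RF.ideal n = R.piece n :=
    ⟨⟨R.piece, R.piece_zero, antitone_piece hR, R.piece_mul_le⟩, fun _ => rfl⟩
  have hI : R.chartIdeals U = (RF.filtration U).ideal :=
    funext fun n => by rw [ReesAlgebraData.chartIdeals_apply, ReesFiltration.filtration_ideal, hRF]
  have hE : extReesAlgebra (R.chartIdeals U) = RF.sectionsRing U := by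
    rw [hI]
    exact bridge Γ(Y, U) (RF.filtration U)
  show Scheme.IsRegular (Spec (.of (extReesAlgebra (R.chartIdeals U)))) ∧
    LocallyOfFiniteType (Spec.map (CommRingCat.ofHom
      (algebraMap Γ(Y, U) (extReesAlgebra (R.chartIdeals U)))))
  rw [hE]
  exact ⟨isRegular_Spec_sectionsRing RF hRF hY hR U,
    (HasRingHomProperty.Spec_iff (P := @LocallyOfFiniteType)).mpr
      (finiteType_algebraMap_sectionsRing RF hRF hY hR U)⟩

end Summit.ResolutionOfSingularities.ResolutionOfSingularities.Theorems

end
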